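import Literature.AlgebraicGeometry.RelativeSpec.GeometricQuotientGroupLaw
import Literature.AlgebraicGeometry.Morphisms.FpqcDescentOfMorphisms
import Mathlib.CategoryTheory.Monoidal.Cartesian.Grp
import HarnessLib

/-!
# The group law descends along an fppf TORSOR quotient `π : A → Q` under a subgroup scheme
# ([MumfordAV1970] §7 Thm. 4 ∕ §12 Thm. 1 (B); [SGA3I] Exp. V Thm. 4.1; [GortzWedhorn2020] Thm. 14.72)

Topic `Literature/AlgebraicGeometry/GroupSchemes`; namespace `Literature.AlgebraicGeometry.GroupSchemes.TorsorQuotient`.  THEOREMS ONLY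
(no definition, no named fact, no instance, no notation, no `sorry`).  Cell `hodgecm-mathlib` (D-0151 ∕ D-0183 FLOOR 0), P6 «MOD programme»,
Row 4B, §Q «quotient of an abelian scheme by a finite flat closed subgroup scheme» of `Cruxes/HLiu418/Lines/F0_P6b_MumfordDualFlat.lean`
(organ Q8 «THE GROUP LAW DESCENDS» of the census `CENSUS-Q-junction.v1`, seat «LH10» LH10-p01 (g17)); generic, count-neutral capital on
`--supports stmt-HodgeConjecture-24832`.  HC_CM is proved only modulo the printed citations until rung 0 closes; nothing here is about HC.

THE PRINT.  [MumfordAV1970] §7 Thm. 4 (p. 72) ∕ §12 Thm. 1 (B) (p. 111): if `π : X → Y` is the quotient of a group scheme by a finite (flat)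
subgroup acting by translations, then `Y` carries a unique group law making `π` a homomorphism; the proof only uses that `π` and `π × π`
are (faithfully flat) epimorphisms and that `X ×_Y X ≅ K × X` («`X` is a `K`-torsor over `Y`», §12 Thm. 1 (B)).  [SGA3I] Exp. V Thm. 4.1:
the same over a base, for finite locally free groupoids.  THIS FILE isolates the descent step in TORSOR currency, with NO finiteness and
NO construction of the quotient: `S` a scheme; `A`, `G` group objects of `Over S` with `A` COMMUTATIVE; `i : G → A` a homomorphism
(the subgroup); `π : A → Q` an `S`-morphism which is flat, surjective and quasi-compact on underlying schemes (an fpqc cover) and whose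
KERNEL PAIR IS THE ACTION: the square `G ⊗ A ⇉ A → Q` with the two arrows `act = (i ▷ A) ≫ μ` («`(g, a) ↦ i(g)·a`») and `pr₂` is
CARTESIAN (`hsq : IsPullback act (snd G A) π π`, i.e. `G ⊗ A ≅ A ×_Q A`).  THEN `Q` carries a group-object structure for which `π` is a
homomorphism, and `Q` is commutative (`exists_grpObj_isMonHom_of_isPullback`).

* §0 `Over.existsUnique_desc_of_pointConstant` — fpqc descent of `S`-morphisms in POINT form: along an fpqc cover `c : W → T` of `S`-schemes a
  morphism `h : W → R` descends (uniquely) as soon as `y₁ ≫ c = y₂ ≫ c ⇒ y₁ ≫ h = y₂ ≫ h` for all `S`-valued test pairs (★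
  `FpqcDescentOfMorphisms.existsUnique_desc_of_pullback_comp_eq` at the kernel pair, made an `S`-morphism by `cancel_epi`).
* §1 the torsor square on points: `mul_comp_eq_of_sq` («`π (i(g) · x) = π x`») and `exists_eq_mul_of_comp_eq` («`π a₁ = π a₂ ⇒ a₂ = i(g) · a₁`
  for some `g`» — the cartesian square).
* §2 `exists_grpObj_isMonHom_of_isPullback` — the law `μ ≫ π` is constant on the fibres of `π ⊗ π` (two applications of §1 and COMMUTATIVITY
  of `A`: `i(g)a · i(g′)b = i(g g′) · ab`), so it descends along the fpqc cover `π ⊗ π` to `μ_Q`; `ι ≫ π` descends along `π` to `ι_Q`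
  (`(i(g)a)⁻¹ = i(g⁻¹) a⁻¹`); `η_Q := η ≫ π`; every axiom is the image of `A`'s under the epimorphisms `π`, `π ⊗ π`, `(π ⊗ π) ⊗ π` — this last
  part verbatim the ★ constant-group road `RelativeSpec/GeometricQuotientGroupLaw.exists_grpObj_isMonHom_of_free`, whose whisker ∕ epi lemmas
  (`isPullback_whiskerRight_left`, `epi_whiskerRight`, `epi_whiskerLeft`, `epi_of_flat_left`) are used BY NAME.

NOT here: the construction of `Q = A ⁄ Z` and of the torsor square (organs Q3–Q7 of the census), separatedness ∕ properness ∕ smoothness of `Q`.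

## References
* [MumfordAV1970] D. Mumford, *Abelian Varieties* (1970), §7 Thm. 4 (p. 72); §12 Thm. 1 (p. 111) and its proof (B) (p. 114).
* [SGA3I] M. Demazure, A. Grothendieck (eds.), *SGA 3, Tome I*, Exp. V (P. Gabriel), Thm. 4.1.
* [GortzWedhorn2020] U. Görtz, T. Wedhorn, *Algebraic Geometry I* (2nd ed., 2020), Thm. 14.72 (fpqc descent of morphisms).
* [MumfordFogartyKirwan1994] D. Mumford, J. Fogarty, F. Kirwan, *GIT* (3rd ed.), Ch. 0 §3 Def. 0.10 (ii) (torsors), Ch. 7 §1 Prop. 7.1.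
-/

noncomputable section

-- Mathlib's `Over`/pull-back API is stated across semireducible wrappers (as in the ★ `GroupSchemes/*` files).
set_option backward.isDefEq.respectTransparency false

universe u

open CategoryTheory Limits AlgebraicGeometry MonoidalCategory CartesianMonoidalCategory MonObj

namespace Literature.AlgebraicGeometry.GroupSchemes.TorsorQuotient

open Literature.AlgebraicGeometry.RelativeSpec.ActionOver.IsGeometricQuotient
  (isPullback_whiskerRight_left isPullback_whiskerLeft_left epi_whiskerRight epi_whiskerLeft epi_of_flat_left)

variable {S : Scheme.{u}}

/-! ## §0 fpqc descent of `S`-morphisms, point form -/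

/-- **fpqc descent of `S`-morphisms, in POINT form** ([GortzWedhorn2020] Thm. 14.72): for an `S`-morphism `c : W → T` whose underlying map is
flat, surjective and quasi-compact, an `S`-morphism `h : W → R` with `y₁ ≫ c = y₂ ≫ c → y₁ ≫ h = y₂ ≫ h` for every pair of `S`-valued test
points DESCENDS UNIQUELY: `∃! f : T → R, c ≫ f = h` (the hypothesis at the kernel pair `W ×_T W ⇉ W`, read as an `S`-scheme, is the descent
datum of ★ `existsUnique_desc_of_pullback_comp_eq`; the descended map is over `S` because `c` is an epimorphism).
[cite: GortzWedhorn2020, Thm. 14.72] [cite: SGA3I, Exp. V Thm. 4.1] -/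
theorem Over.existsUnique_desc_of_pointConstant {W T R : Over S} (c : W ⟶ T) [Flat c.left] [Surjective c.left]
    [QuasiCompact c.left] (h : W ⟶ R)
    (hf : ∀ (T' : Over S) (y₁ y₂ : T' ⟶ W), y₁ ≫ c = y₂ ≫ c → y₁ ≫ h = y₂ ≫ h) : ∃! f : T ⟶ R, c ≫ f = h := by
  -- the kernel pair of `c.left`, as an `S`-scheme with its two test points
  have hw : pullback.snd c.left c.left ≫ W.hom = pullback.fst c.left c.left ≫ W.hom := by
    rw [← Over.w c, ← Category.assoc, ← pullback.condition, Category.assoc]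
  have hh : pullback.fst c.left c.left ≫ h.left = pullback.snd c.left c.left ≫ h.left := by
    have hab : (Over.homMk (pullback.fst c.left c.left) rfl : Over.mk (pullback.fst c.left c.left ≫ W.hom) ⟶ W) ≫ c =
        (Over.homMk (pullback.snd c.left c.left) hw : Over.mk (pullback.fst c.left c.left ≫ W.hom) ⟶ W) ≫ c :=
      Over.OverMorphism.ext pullback.condition
    exact congrArg (fun φ => φ.left) (hf _ _ _ hab)
  obtain ⟨f₀, hf₀, huniq⟩ := Literature.AlgebraicGeometry.Morphisms.existsUnique_desc_of_pullback_comp_eq c.left h.left hh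
  haveI : Epi c.left := Flat.epi_of_flat_of_surjective _
  have hover : f₀ ≫ R.hom = T.hom := by
    rw [← cancel_epi c.left, reassoc_of% hf₀, Over.w h, Over.w c]
  refine ⟨Over.homMk f₀ hover, Over.OverMorphism.ext (by change c.left ≫ f₀ = h.left; exact hf₀), fun f hf' => ?_⟩
  apply Over.OverMorphism.ext
  change f.left = f₀
  exact huniq f.left (by change c.left ≫ f.left = h.left; rw [← Over.comp_left, hf'])

/-! ## §1 The torsor square on points -/

section Square

variable {A G Q : Over S} [GrpObj A] (i : G ⟶ A) (π : A ⟶ Q)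

/-- **Translates by the subgroup die under `π`**: if `act ≫ π = pr₂ ≫ π` for `act = (i ▷ A) ≫ μ` (the commutativity of the torsor square),
then `π (i(g) · x) = π x` for all `T`-points `g` of `G`, `x` of `A`. [cite: MumfordAV1970, §12 Thm. 1 (B) (p. 111)] -/
theorem mul_comp_eq_of_sq (hw : ((i ▷ A) ≫ μ[A]) ≫ π = snd G A ≫ π) {T : Over S} (g : T ⟶ G) (x : T ⟶ A) :
    ((g ≫ i) * x) ≫ π = x ≫ π :=
  calc ((g ≫ i) * x) ≫ π = lift g x ≫ (((i ▷ A) ≫ μ[A]) ≫ π) := by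
        rw [Hom.mul_def, ← lift_whiskerRight]; simp only [Category.assoc]
    _ = x ≫ π := by rw [hw, ← Category.assoc, lift_snd]

/-- **Points with the same image differ by the subgroup** (the torsor square is CARTESIAN): `π a₁ = π a₂ ⇒ a₂ = i(g) · a₁` for some
`T`-point `g` of `G`. [cite: MumfordAV1970, §12 Thm. 1 (B) (p. 111)] [cite: MumfordFogartyKirwan1994, Ch. 0 §3 Def. 0.10 (ii)] -/
theorem exists_eq_mul_of_comp_eq (hsq : IsPullback ((i ▷ A) ≫ μ[A]) (snd G A) π π) {T : Over S} (a₁ a₂ : T ⟶ A)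
    (h : a₁ ≫ π = a₂ ≫ π) : ∃ g : T ⟶ G, a₂ = (g ≫ i) * a₁ := by
  refine ⟨hsq.lift a₂ a₁ h.symm ≫ fst G A, ?_⟩
  have hγ : lift (hsq.lift a₂ a₁ h.symm ≫ fst G A) a₁ = hsq.lift a₂ a₁ h.symm := by
    conv_rhs => rw [← lift_comp_fst_snd (hsq.lift a₂ a₁ h.symm)]
    rw [hsq.lift_snd]
  rw [Hom.mul_def, ← lift_whiskerRight, hγ, Category.assoc, hsq.lift_fst]

end Square

/-! ## §2 The group law descends -/

/-- **THE GROUP LAW DESCENDS ALONG AN fppf TORSOR QUOTIENT** ([MumfordAV1970] §7 Thm. 4 ∕ §12 Thm. 1 (B); [SGA3I] V 4.1).  `A`, `G` group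
objects of `Over S` with `A` COMMUTATIVE, `i : G → A` a homomorphism, `π : A → Q` over `S` flat, surjective and quasi-compact on underlying
schemes, with CARTESIAN torsor square `hsq : IsPullback ((i ▷ A) ≫ μ) (snd G A) π π` (`G ⊗ A ≅ A ×_Q A` by `(g, a) ↦ (i(g)·a, a)`).  Then
there is a group-object structure on `Q` for which `π` is a homomorphism (`η_Q = η ≫ π`, `(π ⊗ₘ π) ≫ μ_Q = μ ≫ π`, `π ≫ ι_Q = ι ≫ π`),
and it is COMMUTATIVE (braiding naturality + `cancel_epi (π ⊗ₘ π)`).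
Proof: `μ ≫ π` is constant on the fibres of the fpqc cover `π ⊗ₘ π` — if `π aᵢ`, `π bᵢ` agree then `a₂ = i(g) a₁`, `b₂ = i(g′) b₁` (§1) and
`a₂ b₂ = i(g g′) · (a₁ b₁)` by commutativity — so it descends (§0) to `μ_Q`; likewise `ι ≫ π` along `π` (`(i(g) a)⁻¹ = i(g⁻¹) a⁻¹`); the
axioms transfer along the epimorphisms `π`, `π ⊗ₘ π`, `(π ⊗ₘ π) ⊗ₘ π` exactly as in ★ `GeometricQuotientGroupLaw`.
[cite: MumfordAV1970, §7 Thm. 4 (p. 72) and §12 Thm. 1 (p. 111)] [cite: SGA3I, Exp. V Thm. 4.1] [cite: GortzWedhorn2020, Thm. 14.72] -/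
theorem exists_grpObj_isMonHom_of_isPullback {A G Q : Over S} [GrpObj A] [IsCommMonObj A] [GrpObj G] (i : G ⟶ A) [IsMonHom i]
    (π : A ⟶ Q) [Flat π.left] [Surjective π.left] [QuasiCompact π.left]
    (hsq : IsPullback ((i ▷ A) ≫ μ[A]) (snd G A) π π) : ∃ _ : GrpObj Q, IsMonHom π ∧ IsCommMonObj Q := by
  have hw : ((i ▷ A) ≫ μ[A]) ≫ π = snd G A ≫ π := hsq.w
  -- the fpqc covers `π ▷ A`, `Q ◁ π`, `π ⊗ₘ π`
  haveI : Flat (π ▷ A).left := MorphismProperty.of_isPullback (isPullback_whiskerRight_left π A) ‹Flat π.left›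
  haveI : Surjective (π ▷ A).left := MorphismProperty.of_isPullback (isPullback_whiskerRight_left π A) ‹Surjective π.left›
  haveI : QuasiCompact (π ▷ A).left := MorphismProperty.of_isPullback (isPullback_whiskerRight_left π A) ‹QuasiCompact π.left›
  haveI : Flat (Q ◁ π).left := MorphismProperty.of_isPullback (isPullback_whiskerLeft_left π Q) ‹Flat π.left›
  haveI : Surjective (Q ◁ π).left := MorphismProperty.of_isPullback (isPullback_whiskerLeft_left π Q) ‹Surjective π.left›
  haveI : QuasiCompact (Q ◁ π).left := MorphismProperty.of_isPullback (isPullback_whiskerLeft_left π Q) ‹QuasiCompact π.left›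
  haveI : Flat (π ⊗ₘ π).left := by rw [tensorHom_def, Over.comp_left]; infer_instance
  haveI : Surjective (π ⊗ₘ π).left := by rw [tensorHom_def, Over.comp_left]; infer_instance
  haveI : QuasiCompact (π ⊗ₘ π).left := by rw [tensorHom_def, Over.comp_left]; infer_instance
  -- (1) the law `μ ≫ π` is constant on the fibres of `π ⊗ₘ π`, hence descends
  have hfμ : ∀ (T' : Over S) (y₁ y₂ : T' ⟶ A ⊗ A), y₁ ≫ (π ⊗ₘ π) = y₂ ≫ (π ⊗ₘ π) →
      y₁ ≫ (μ[A] ≫ π) = y₂ ≫ (μ[A] ≫ π) := by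
    intro T' y₁ y₂ hy
    have ha : (y₁ ≫ fst A A) ≫ π = (y₂ ≫ fst A A) ≫ π := by
      have e := congrArg (· ≫ fst Q Q) hy
      simpa only [Category.assoc, tensorHom_fst] using e
    have hb : (y₁ ≫ snd A A) ≫ π = (y₂ ≫ snd A A) ≫ π := by
      have e := congrArg (· ≫ snd Q Q) hy
      simpa only [Category.assoc, tensorHom_snd] using e
    obtain ⟨g, hg⟩ := exists_eq_mul_of_comp_eq i π hsq _ _ ha
    obtain ⟨g', hg'⟩ := exists_eq_mul_of_comp_eq i π hsq _ _ hb
    have hy₁ : y₁ ≫ μ[A] = (y₁ ≫ fst A A) * (y₁ ≫ snd A A) := by rw [Hom.mul_def, lift_comp_fst_snd]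
    have hy₂ : y₂ ≫ μ[A] = (y₂ ≫ fst A A) * (y₂ ≫ snd A A) := by rw [Hom.mul_def, lift_comp_fst_snd]
    have hprod : (y₂ ≫ fst A A) * (y₂ ≫ snd A A) = ((g * g') ≫ i) * ((y₁ ≫ fst A A) * (y₁ ≫ snd A A)) := by
      rw [hg, hg', MonObj.mul_comp, _root_.mul_mul_mul_comm]
    rw [← Category.assoc, ← Category.assoc, hy₁, hy₂, hprod, mul_comp_eq_of_sq i π hw]
  obtain ⟨mQ, hmQ, -⟩ := Over.existsUnique_desc_of_pointConstant (π ⊗ₘ π) (μ[A] ≫ π) hfμ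
  -- (2) the inverse `ι ≫ π` is constant on the fibres of `π`, hence descends
  have hfι : ∀ (T' : Over S) (y₁ y₂ : T' ⟶ A), y₁ ≫ π = y₂ ≫ π → y₁ ≫ (ι[A] ≫ π) = y₂ ≫ (ι[A] ≫ π) := by
    intro T' y₁ y₂ hy
    obtain ⟨g, hg⟩ := exists_eq_mul_of_comp_eq i π hsq _ _ hy
    have h₂ : y₂ ≫ ι[A] = (g⁻¹ ≫ i) * (y₁ ≫ ι[A]) := by
      rw [← Hom.inv_def, ← Hom.inv_def, hg, mul_inv_rev, mul_comm, GrpObj.inv_comp]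
    rw [← Category.assoc, ← Category.assoc, h₂, mul_comp_eq_of_sq i π hw]
  obtain ⟨iQ, hiQ, -⟩ := Over.existsUnique_desc_of_pointConstant π (ι[A] ≫ π) hfι
  -- epimorphisms used to transfer the axioms
  haveI : Epi π := epi_of_flat_left π
  haveI : Epi (π ⊗ₘ π) := by
    rw [tensorHom_def]; haveI := epi_whiskerRight π A; haveI := epi_whiskerLeft π Q
    exact epi_comp _ _
  haveI : Epi ((π ⊗ₘ π) ⊗ₘ π) := by
    rw [tensorHom_def]; haveI := epi_whiskerRight (π ⊗ₘ π) A; haveI := epi_whiskerLeft π (Q ⊗ Q)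
    exact epi_comp _ _
  haveI := epi_whiskerLeft π (𝟙_ (Over S))
  haveI := epi_whiskerRight π (𝟙_ (Over S))
  -- the axioms, transferred along the epimorphisms (verbatim the ★ constant-group road)
  have h_one_mul : ((η[A] ≫ π) ▷ Q) ≫ mQ = (λ_ Q).hom := by
    rw [← cancel_epi (𝟙_ (Over S) ◁ π), whisker_exchange_assoc, comp_whiskerRight, Category.assoc,
      ← tensorHom_def_assoc π π mQ, hmQ, MonObj.one_mul_assoc, leftUnitor_naturality]
  have h_mul_one : (Q ◁ (η[A] ≫ π)) ≫ mQ = (ρ_ Q).hom := by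
    rw [← cancel_epi (π ▷ 𝟙_ (Over S)), ← whisker_exchange_assoc, MonoidalCategory.whiskerLeft_comp,
      Category.assoc, ← tensorHom_def'_assoc π π mQ, hmQ, MonObj.mul_one_assoc, rightUnitor_naturality]
  have hππ : ((π ⊗ₘ π) ⊗ₘ π) ≫ (mQ ▷ Q) = (μ[A] ▷ A) ≫ (π ⊗ₘ π) := by
    rw [tensorHom_def (π ⊗ₘ π) π, Category.assoc, whisker_exchange mQ π, ← comp_whiskerRight_assoc,
      hmQ, comp_whiskerRight, Category.assoc, ← tensorHom_def π π]
  have hππ' : (π ⊗ₘ (π ⊗ₘ π)) ≫ (Q ◁ mQ) = (A ◁ μ[A]) ≫ (π ⊗ₘ π) := by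
    rw [tensorHom_def π (π ⊗ₘ π), Category.assoc, ← MonoidalCategory.whiskerLeft_comp, hmQ,
      MonoidalCategory.whiskerLeft_comp, ← whisker_exchange_assoc π μ[A], ← tensorHom_def π π]
  have h_mul_assoc : (mQ ▷ Q) ≫ mQ = (α_ Q Q Q).hom ≫ (Q ◁ mQ) ≫ mQ := by
    rw [← cancel_epi ((π ⊗ₘ π) ⊗ₘ π), reassoc_of% hππ, hmQ, associator_naturality_assoc,
      reassoc_of% hππ', hmQ, MonObj.mul_assoc_assoc]
  have h_left_inv : lift iQ (𝟙 Q) ≫ mQ = toUnit Q ≫ η[A] ≫ π := by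
    rw [← cancel_epi π, comp_lift_assoc, hiQ, Category.comp_id, comp_toUnit_assoc,
      show lift (ι[A] ≫ π) π = lift ι[A] (𝟙 A) ≫ (π ⊗ₘ π) by rw [lift_map, Category.id_comp],
      Category.assoc, hmQ, GrpObj.left_inv_assoc]
  have h_right_inv : lift (𝟙 Q) iQ ≫ mQ = toUnit Q ≫ η[A] ≫ π := by
    rw [← cancel_epi π, comp_lift_assoc, hiQ, Category.comp_id, comp_toUnit_assoc,
      show lift π (ι[A] ≫ π) = lift (𝟙 A) ι[A] ≫ (π ⊗ₘ π) by rw [lift_map, Category.id_comp],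
      Category.assoc, hmQ, GrpObj.right_inv_assoc]
  have h_comm : (β_ Q Q).hom ≫ mQ = mQ := by
    rw [← cancel_epi (π ⊗ₘ π), BraidedCategory.braiding_naturality_assoc, hmQ, ← Category.assoc, IsCommMonObj.mul_comm]
  -- the group object
  letI mon : MonObj Q :=
    { one := η[A] ≫ π
      mul := mQ
      one_mul := h_one_mul
      mul_one := h_mul_one
      mul_assoc := h_mul_assoc }
  exact ⟨{ inv := iQ, left_inv := h_left_inv, right_inv := h_right_inv },
    { one_hom := rfl, mul_hom := hmQ.symm }, { mul_comm := h_comm }⟩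

end Literature.AlgebraicGeometry.GroupSchemes.TorsorQuotient

end
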